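import Summits.BirchSwinnertonDyer.BirchSwinnertonDyer.Theorems.GoldfeldAllTwistsTwoConverseTwinAdditiveTorsion
import Summits.BirchSwinnertonDyer.BirchSwinnertonDyer.Theorems.GoldfeldAllTwistsTwoConverseTwinAdditiveTamagawaProduct
import HarnessLib

set_option linter.dupNamespace false -- `…BirchSwinnertonDyer.BirchSwinnertonDyer…` is the cell's namespace (D-0017)
set_option autoImplicit false

/-!
# Twin″ (item 19140), the WHOLE additive cell — uniform arithmetic, VII: **`#Ш_an(W) = 4·L^{(r)}(W,1)/r! /
# (Ω_W · 2^(3+ι(d)+2σ(d)) · Reg_W)`** for EVERY curve of the cell, and the UNIFORM RESIDUAL of twin″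
# **`BSD(W,2) ⟺ ord₂ (L^{(r)}/(Ω_W·Reg_W)) = 1 + ι + 2σ + ord₂ #Ш(W)[2^∞]`** (files V + VI assembled)

Cell `bsd-goldfeld`, seat `bsd-goldfeld-s1p-c301` (prover, gen 11). Support for item `stmt-BirchSwinnertonDyer-19140`
(crux twin″ `BSDTwoCMSevenAdditiveRankOne` = Miller's `BSD(W,2)`: `rank = r_an`, `Ш(2)` finite, `ord₂ #Ш_an(W) = ord₂ #Ш(W)(2)`).
Theses-free; theorems only; no `sorry`. HONEST FRAMING: an identity between the tree's BSD invariants of the curves of the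
cell; nothing is claimed about `L′(W,1)` or `Ш`; BSD is not proved by any of this and no case of twin″ is claimed.

For every model `W` of `49a1^{(d)}` (`C • W = X₀(49)^{(d)}`, `d` squarefree, `d ≢ 1 (mod 4)`, `7 ∤ d` — the cell's
coordinates, seat c301 gen 3 `bsdTwoCMSevenAdditiveRankOne_iff_negTwists`): `#W(ℚ)_tors = 2` (file VI
`torsionOrder_eq_two_of_smul_eq_cm7_quadraticTwist`) and `∏_p c_p(W) = 8·∏_{ℓ∣d odd} c_ℓ = 2^(3+ι+2σ)` (file V
`tamagawaProduct_eq_of_smul_eq_cm7_quadraticTwist`), so Miller's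
`#Ш_an(W) = L^{(r)}(W,1)/r! · #W(ℚ)_tors² / (Ω_W · ∏c_p · Reg_W)` (`shaAn`, [Miller2011LMS] §1) reads
**`shaAn W = 4 · leadingLCoeff W / (Ω_W · (8·∏_{ℓ∣d odd} c_ℓ) · Reg_W)`** (`shaAn_eq_of_smul_eq_cm7_quadraticTwist`), with
`ord₂ (∏ c_p) = 3 + ι(d) + 2σ(d)` (`padicValNat_two_tamagawaProduct_of_smul_eq_cm7_quadraticTwist`). Hence **the UNIFORM
RESIDUAL of twin″ on the whole cell** (`bsdp_two_iff_of_smul_eq_cm7_quadraticTwist`): granted `rank = r_an` and `Ш` finite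
(Gross–Zagier–Kolyvagin, hypotheses) and `L^{(r)}(W,1) ≠ 0` (hypothesis),
`BSD(W,2) ⟺ ∃ q ∈ ℚ, L^{(r)}(W,1)/r!/(Ω_W·Reg_W) = q ∧ ord₂ q = 1 + ι(d) + 2σ(d) + ord₂ #Ш(W)[2^∞]` — the statement the cell's
BSD(E,2) census (7975 rank-one rows `|d| ≤ 20000`, 0 violations) tests row by row, and which THEOREM B / B′ prove on F1 / F2
(`ι + 2σ = 1`, `Ш[2] = 0`: «`ord₂ (L′/ΩR) = 2`»). References: [Miller2011LMS] Def. 1.1; [SilvermanAEC2009] VII.6, VIII.7; [Silverman1994] IV.9 Table 4.1.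
-/

noncomputable section

open scoped Classical NumberField

open WeierstrassCurve IsDedekindDomain IsLocalRing Rat.HeightOneSpectrum
  Literature.NumberTheory.EllipticCurves Literature.NumberTheory.EllipticCurves.ModularForms
  Literature.NumberTheory.QuadraticForms

namespace Summit.BirchSwinnertonDyer.BirchSwinnertonDyer.Theorems.GoldfeldGoodTwists

section ShaAn

variable {d : ℤ}

/-- **`ord₂ ∏_p c_p(W) = 3 + ι(d) + 2σ(d)` for every model `W` of `49a1^{(d)}`** (`d` squarefree, `d ≢ 1 (mod 4)`, `7 ∤ d`;
`ι` / `σ` = number of odd prime factors `ℓ` of `d` with `(ℓ/7) = −1` / `≠ −1`). [cite: Silverman1994, IV.9.4 and Table 4.1] -/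
theorem padicValNat_two_tamagawaProduct_of_smul_eq_cm7_quadraticTwist (hsq : Squarefree d) (hd4 : d % 4 ≠ 1)
    (h7 : ¬ (7 : ℤ) ∣ d) (W : WeierstrassCurve ℚ) [W.IsElliptic] (C : VariableChange ℚ)
    (hC : C • W = cm7.quadraticTwist (d : ℚ)) :
    padicValNat 2 W.tamagawaProduct =
      3 + ((d.natAbs.primeFactors.erase 2).filter (fun l : ℕ => jacobiSym l 7 = -1)).card +
        2 * ((d.natAbs.primeFactors.erase 2).filter (fun l : ℕ => ¬ jacobiSym l 7 = -1)).card := by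
  have hd : (((4 * d : ℤ)) : ℚ) ≠ 0 := by
    have := hsq.ne_zero; exact_mod_cast (show (4 * d : ℤ) ≠ 0 by omega)
  haveI := cm7.isElliptic_quadraticTwist hd
  obtain ⟨C', hC'⟩ := exists_smul_eq_cellModel_baseChange W hC
  rw [cellModel_baseChange] at hC'
  have h := tamagawaProduct_variableChange_eq W C'
  rw [hC'] at h
  rw [← h, tamagawaProduct_cellTwist_eq_two_pow hsq hd4 h7, padicValNat.prime_pow]

/-- **`#Ш_an(W) = 4 · L^{(r)}(W,1)/r! / (Ω_W · (8·∏_{ℓ∣d odd} c_ℓ) · Reg_W)` for every model `W` of `49a1^{(d)}`**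
(`d` squarefree, `d ≢ 1 (mod 4)`, `7 ∤ d`): Miller's `#Ш_an` with the cell's uniform torsion (`#W(ℚ)_tors = 2`, file VI)
and Tamagawa law (file V) substituted. [cite: Miller2011LMS, §1 and Def. 1.1 (arXiv:1010.2431 p. 3)] -/
theorem shaAn_eq_of_smul_eq_cm7_quadraticTwist (hsq : Squarefree d) (hd4 : d % 4 ≠ 1) (h7 : ¬ (7 : ℤ) ∣ d)
    (W : WeierstrassCurve ℚ) [W.IsElliptic] (C : VariableChange ℚ) (hC : C • W = cm7.quadraticTwist (d : ℚ)) :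
    shaAn W = W.leadingLCoeff * 4 /
      ((W.realPeriodRat : ℂ) *
        ((8 * ∏ l ∈ (d.natAbs.primeFactors.erase 2), (if jacobiSym l 7 = -1 then 2 else 4) : ℕ) : ℂ) *
          (W.regulator : ℂ)) := by
  rw [shaAn_def, torsionOrder_eq_two_of_smul_eq_cm7_quadraticTwist hsq hd4 h7 W C hC,
    tamagawaProduct_eq_of_smul_eq_cm7_quadraticTwist hsq hd4 h7 W C hC]
  push_cast
  ring

/-- **THE UNIFORM RESIDUAL OF TWIN″ ON THE ADDITIVE CELL.** For every model `W` of `49a1^{(d)}` (`d` squarefree,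
`d ≢ 1 (mod 4)`, `7 ∤ d`) with `rank W(ℚ) = ord_{s=1} L(W,s)` and `Ш(W)` finite (both Gross–Zagier–Kolyvagin in analytic
rank `1`, by name at the call site) and `L^{(r)}(W,1) ≠ 0` (tree fact `leadingLCoeff_ne_zero`, by name at the call site):
**`BSD(W,2) ⟺ ∃ q ∈ ℚ, L^{(r)}(W,1)/r!/(Ω_W·Reg_W) = q ∧ ord₂ q = 1 + ι(d) + 2σ(d) + ord₂ #Ш(W)[2^∞]`** — Miller's
`ord₂ #Ш_an = ord₂ #Ш(2)` with `#Ш_an = 4·L^{(r)}/(Ω·2^(3+ι+2σ)·Reg)`. On F1/F2 (`ι + 2σ = 1`, `Ш[2] = 0`) this is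
«`ord₂ (L′/ΩR) = 2`», which THEOREM B / B′ prove modulo print. [cite: Miller2011LMS, Def. 1.1 (arXiv:1010.2431 p. 3)] -/
theorem bsdp_two_iff_of_smul_eq_cm7_quadraticTwist (hsq : Squarefree d) (hd4 : d % 4 ≠ 1) (h7 : ¬ (7 : ℤ) ∣ d)
    (W : WeierstrassCurve ℚ) [W.IsElliptic] (C : VariableChange ℚ) (hC : C • W = cm7.quadraticTwist (d : ℚ))
    (hrank : W.mordellWeilRank = W.analyticRank) (hfin : Finite W.sha) (hL : W.leadingLCoeff ≠ 0) :
    BSDp W 2 ↔ ∃ q : ℚ, W.leadingLCoeff / ((W.realPeriodRat : ℂ) * (W.regulator : ℂ)) = (q : ℂ) ∧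
      padicValRat 2 q =
        ((1 + ((d.natAbs.primeFactors.erase 2).filter (fun l : ℕ => jacobiSym l 7 = -1)).card +
            2 * ((d.natAbs.primeFactors.erase 2).filter (fun l : ℕ => ¬ jacobiSym l 7 = -1)).card : ℕ) : ℤ) +
          padicValNat 2 (Nat.card (AddCommGroup.primaryComponent W.sha 2)) := by
  -- abbreviations
  set e : ℕ := ((d.natAbs.primeFactors.erase 2).filter (fun l : ℕ => jacobiSym l 7 = -1)).card +
    2 * ((d.natAbs.primeFactors.erase 2).filter (fun l : ℕ => ¬ jacobiSym l 7 = -1)).card with he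
  set s : ℕ := padicValNat 2 (Nat.card (AddCommGroup.primaryComponent W.sha 2)) with hs
  -- the cell's uniform invariants
  have hd : (((4 * d : ℤ)) : ℚ) ≠ 0 := by
    have := hsq.ne_zero; exact_mod_cast (show (4 * d : ℤ) ≠ 0 by omega)
  haveI := cm7.isElliptic_quadraticTwist hd
  have hTam : W.tamagawaProduct = 2 ^ (3 + e) := by
    obtain ⟨C', hC'⟩ := exists_smul_eq_cellModel_baseChange W hC
    rw [cellModel_baseChange] at hC'
    have h := tamagawaProduct_variableChange_eq W C'
    rw [hC'] at h
    rw [← h, tamagawaProduct_cellTwist_eq_two_pow hsq hd4 h7, he, add_assoc]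
  have htors : W.torsionOrder = 2 := torsionOrder_eq_two_of_smul_eq_cm7_quadraticTwist hsq hd4 h7 W C hC
  have hΩ : (W.realPeriodRat : ℂ) ≠ 0 := by
    have h : 0 < W.realPeriodRat := realPeriodRat_pos_holds W
    exact_mod_cast h.ne'
  have hR : (W.regulator : ℂ) ≠ 0 := by
    have h : 0 < W.regulator := regulator_pos_holds W
    exact_mod_cast h.ne'
  haveI : Finite (AddCommGroup.primaryComponent W.sha 2) := inferInstance
  -- `shaAn W = (L/(ΩR)) / 2^(1+e)`
  have hsha : shaAn W = W.leadingLCoeff / ((W.realPeriodRat : ℂ) * (W.regulator : ℂ)) / (2 : ℂ) ^ (1 + e) := by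
    rw [shaAn_def, htors, hTam]
    push_cast
    field_simp
    ring
  have h2e : ((2 : ℚ) ^ (1 + e)) ≠ 0 := pow_ne_zero _ two_ne_zero
  have hv2 : padicValRat 2 (2 : ℚ) = 1 := by exact_mod_cast padicValRat.self (p := 2) one_lt_two
  have hv2e : padicValRat 2 ((2 : ℚ) ^ (1 + e)) = (1 + e : ℕ) := by
    rw [padicValRat.pow (2 : ℚ), hv2]
    push_cast; ring
  constructor
  · intro h
    obtain ⟨-, -, q, hq, hv⟩ := (bsdp_iff W 2).mp h
    refine ⟨q * 2 ^ (1 + e), ?_, ?_⟩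
    · rw [hsha] at hq
      push_cast
      rw [← hq]
      field_simp
    · have hq0 : q ≠ 0 := by
        rintro rfl
        rw [hsha, Rat.cast_zero, div_eq_zero_iff, div_eq_zero_iff] at hq
        rcases hq with (h | h) | h
        · exact hL h
        · exact mul_ne_zero hΩ hR h
        · exact pow_ne_zero _ two_ne_zero h
      rw [padicValRat.mul hq0 h2e, hv, hv2e, ← hs, he]
      push_cast; ring
  · rintro ⟨q, hq, hv⟩
    have hq0 : q ≠ 0 := by
      rintro rfl
      rw [Rat.cast_zero, div_eq_zero_iff] at hq
      rcases hq with h | h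
      · exact hL h
      · exact mul_ne_zero hΩ hR h
    refine (bsdp_iff W 2).mpr ⟨hrank, inferInstance, q / 2 ^ (1 + e), ?_, ?_⟩
    · rw [hsha, hq]; push_cast; ring
    · rw [padicValRat.div hq0 h2e, hv, hv2e, ← hs, he]
      push_cast; ring

end ShaAn

end Summit.BirchSwinnertonDyer.BirchSwinnertonDyer.Theorems.GoldfeldGoodTwists

end
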